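import Mathlib
import Summits.ABC.ABC.Theorems.SoloInformedOnePrime
import Literature.NumberTheory.DiophantineGeometry.StewartPadicOrderLemma8Proofs

/-!
# Solo (informed) — the one-prime face on Stewart's range (session 7: a correction)

`W(p) = v_p(2^(p-1) - 1)` is the Wieferich exponent, `e_p = ord_p(2)`, `i_p = (p-1)/e_p` the
residual index. The one-prime prediction of abc (face (F5), `soloInformed_onePrime_of_abc`) is
`W(p)·log p ≤ ε·e_p·log 2 + K_ε`; the trivial (Liouville) bound is `W(p)·log p < e_p·log 2`
(`soloInformed_wieferichExp_mul_log_lt`).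

**Correction of the significance claims made in `SoloInformedOnePrimeSubgroup`,
`SoloInformedOnePrimeGrowingIndex`, `SoloInformedTheoremB` (2026-08-18).** Those files call the
subgroup-restricted two-logarithm bound (hypothesis `hH`, "Theorem C") the first sub-Liouville
bound for `W(p)` at unbounded index, and present (F5) on the set `(log i_p)^4 ≤ δ·log p`
("Corollary D") as new. Both descriptions are wrong as statements about the literature:
C. L. Stewart, *On divisors of Lucas and Lehmer numbers*, Acta Math. 211 (2013), Theorem 2 —
vendored in this tree since 2026-08-15 as the named fact `stewart2013_thm2`
(`Literature/NumberTheory/DiophantineGeometry/StewartPadicOrder.lean`) and REDUCED in the kernel to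
K. Yu's 2013 theorem over `ℚ` (`Stewart2013_lemma5_rat`) in `StewartPadicOrderLemma8Proofs.lean` —
gives, at `(a, b) = (2, 1)`,

  `W(p) < p · exp(-log p / (52 log log p)) · log 2`   for `p > P₀`,

by inflating the number of logarithms in Yu's bound with `⌊log p/(51.8 log log p)⌋` auxiliary
small primes. This is sub-Liouville exactly when `i_p · log p < exp(log p/(52 log log p))`, a
range that contains, for large `p`, every prime with `(log i_p)^4 ≤ log p`. The theorems below
prove this containment in the kernel:

* `soloInformed_wieferichExp_lt_of_stewartThm2` — the specialisation `(a,b) = (2,1)`;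
* `soloInformed_onePrime_stewartRange_of_stewartThm2` — (F5) for every odd prime with
  `i_p · log p ≤ ε · exp(log p/(52 log log p))`;
* `soloInformed_corollaryD_of_stewartThm2` — the exact statement of "Corollary D"
  (`soloInformed_onePrime_growingIndex_of_subgroupTwoLogBound`) from `stewart2013_thm2` alone;
* `soloInformed_corollaryD_of_lemma5Rat` — hence from Yu's theorem `Stewart2013_lemma5_rat`
  (through the tree's `stewart2013_thm2_of_Stewart2013_lemma5_rat`), with no two-logarithm input
  and no subgroup restriction.

What survives of the earlier files is only what they prove: explicit inequalities under the
explicit hypotheses `hH` / `hA` (whose constants make them non-trivial in a window of moderate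
`p`, roughly `e^700 < p < e^4500`, where Stewart's bound with its inexplicit `P₀` and the factor
`exp(-log p/(52 log log p)) > 1/log p` is not yet below Liouville's). The open residue of (F5) is
`i_p ≳ exp(log p/(52 log log p))/log p`, not `i_p ≫ log p`.
-/

namespace Summit.ABC.ABC.Theorems

open Literature.NumberTheory.DiophantineGeometry.Dioph

/-- **Stewart 2013, Theorem 2 at `(a, b) = (2, 1)`.** Under the named fact `stewart2013_thm2`
there is `P₀` with `W(p) = v_p(2^(p-1) - 1) < p · exp(-log p/(52 log log p)) · log 2` for every
prime `p > P₀`. -/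
theorem soloInformed_wieferichExp_lt_of_stewartThm2 (hS : stewart2013_thm2) :
    ∃ P₀ : ℝ, 2 ≤ P₀ ∧ ∀ p : ℕ, p.Prime → P₀ < p →
      (padicValNat p (2 ^ (p - 1) - 1) : ℝ) <
        (p : ℝ) * Real.exp (-Real.log p / (52 * Real.log (Real.log p))) * Real.log 2 := by
  obtain ⟨C₁, hC⟩ := hS.wieferichOrder
  refine ⟨max (C₁ (ArithmeticFunction.cardDistinctFactors (2 * 1))) 2, le_max_right _ _,
    fun p hp hpP => ?_⟩
  have hC₁ : C₁ (ArithmeticFunction.cardDistinctFactors (2 * 1)) < p :=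
    lt_of_le_of_lt (le_max_left _ _) hpP
  have hp2 : (2 : ℝ) < p := lt_of_le_of_lt (le_max_right _ _) hpP
  have hp2' : p ≠ 2 := by
    intro h; rw [h] at hp2; norm_num at hp2
  have hndvd : ¬ p ∣ 2 * 1 := by
    rw [mul_one]
    intro h
    exact hp2' ((Nat.prime_dvd_prime_iff_eq hp Nat.prime_two).mp h)
  have key := hC 2 1 one_pos (by norm_num) p hp hndvd hC₁
  rw [padicValInt_natCast_pow_sub_pow p (p - 1) (by norm_num : 1 ≤ 2), one_pow] at key
  exact_mod_cast key

/-- **(F5) on Stewart's range.** Under `stewart2013_thm2`: for every `ε > 0` there is `K` such that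
`W(p)·log p ≤ ε·e_p·log 2 + K` for every odd prime `p` whose residual index `i_p = (p-1)/e_p`
satisfies `i_p · log p ≤ ε · exp(log p/(52 log log p))`. -/
theorem soloInformed_onePrime_stewartRange_of_stewartThm2 (hS : stewart2013_thm2) {ε : ℝ}
    (hε : 0 < ε) :
    ∃ K : ℝ, ∀ p : ℕ, p.Prime → p ≠ 2 →
      ((p : ℝ) - 1) / (orderOf (2 : ZMod p) : ℝ) * Real.log p ≤
          ε * Real.exp (Real.log p / (52 * Real.log (Real.log p))) →
      (padicValNat p (2 ^ (p - 1) - 1) : ℝ) * Real.log p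
        ≤ ε * (orderOf (2 : ZMod p) : ℝ) * Real.log 2 + K := by
  obtain ⟨P₀, hP2, hP⟩ := soloInformed_wieferichExp_lt_of_stewartThm2 hS
  have hlog2 : 0 < Real.log 2 := Real.log_pos one_lt_two
  refine ⟨P₀ * Real.log 2 + ε * Real.log 2, fun p hp hp2 hreg => ?_⟩
  haveI : Fact p.Prime := ⟨hp⟩
  have h2ne0 : (2 : ZMod p) ≠ 0 := by
    intro h
    have : p ∣ 2 := (ZMod.natCast_eq_zero_iff 2 p).mp (by exact_mod_cast h)
    exact hp2 ((Nat.prime_dvd_prime_iff_eq hp Nat.prime_two).mp this)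
  have htriv := soloInformed_wieferichExp_mul_log_lt hp hp2
  set e : ℕ := orderOf (2 : ZMod p) with he
  have hediv : e ∣ p - 1 := ZMod.orderOf_dvd_card_sub_one h2ne0
  clear_value e
  have hp3 : 3 ≤ p := by have := hp.two_le; omega
  have hp1pos : 0 < p - 1 := by omega
  have hepos : 0 < e := Nat.pos_of_dvd_of_pos hediv hp1pos
  have hele : e ≤ p - 1 := Nat.le_of_dvd hp1pos hediv
  have hpR : (3 : ℝ) ≤ (p : ℝ) := by exact_mod_cast hp3
  have heR : (0 : ℝ) < (e : ℝ) := by exact_mod_cast hepos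
  have heleR : (e : ℝ) ≤ (p : ℝ) - 1 := by
    have : ((e : ℕ) : ℝ) ≤ ((p - 1 : ℕ) : ℝ) := by exact_mod_cast hele
    rw [Nat.cast_sub hp.one_le] at this
    simpa using this
  have hLpos : 0 < Real.log p := Real.log_pos (by linarith)
  set W : ℝ := (padicValNat p (2 ^ (p - 1) - 1) : ℝ) with hW
  have hεe : 0 ≤ ε * (e : ℝ) * Real.log 2 := by positivity
  by_cases hsmall : (p : ℝ) ≤ P₀
  · -- small primes: Liouville's bound `W log p < e log 2 ≤ (p-1) log 2 ≤ P₀ log 2`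
    have h1 : (e : ℝ) * Real.log 2 ≤ P₀ * Real.log 2 :=
      mul_le_mul_of_nonneg_right (by linarith) hlog2.le
    have h2 : 0 ≤ ε * Real.log 2 := by positivity
    linarith
  push Not at hsmall
  have hSt := hP p hp hsmall
  -- `x = log p / (52 log log p)`; the two exponentials are inverse to each other
  set x : ℝ := Real.log p / (52 * Real.log (Real.log p)) with hx
  have hneg : -Real.log (p : ℝ) / (52 * Real.log (Real.log p)) = -x := by
    rw [hx, neg_div]
  rw [hneg] at hSt
  have hEE : Real.exp (-x) * Real.exp x = 1 := by
    rw [← Real.exp_add]; simp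
  have hEpos : 0 < Real.exp (-x) := Real.exp_pos _
  -- from the regime: `(p - 1) log p ≤ ε e exp x`
  have hreg' : ((p : ℝ) - 1) * Real.log p ≤ ε * (e : ℝ) * Real.exp x := by
    have := mul_le_mul_of_nonneg_left hreg heR.le
    calc ((p : ℝ) - 1) * Real.log p = (e : ℝ) * (((p : ℝ) - 1) / (e : ℝ) * Real.log p) := by
          field_simp
      _ ≤ (e : ℝ) * (ε * Real.exp x) := this
      _ = ε * (e : ℝ) * Real.exp x := by ring
  -- hence `(p - 1) log p exp(-x) ≤ ε e`
  have hmain : ((p : ℝ) - 1) * Real.log p * Real.exp (-x) ≤ ε * (e : ℝ) := by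
    calc ((p : ℝ) - 1) * Real.log p * Real.exp (-x)
        ≤ ε * (e : ℝ) * Real.exp x * Real.exp (-x) := mul_le_mul_of_nonneg_right hreg' hEpos.le
      _ = ε * (e : ℝ) * (Real.exp (-x) * Real.exp x) := by ring
      _ = ε * (e : ℝ) := by rw [hEE, mul_one]
  -- and `p = (p-1) + 1`, `log p exp(-x) ≤ (p-1) log p exp(-x)` is not needed: use `e ≤ p - 1`
  have hp1 : (1 : ℝ) ≤ (p : ℝ) - 1 := by linarith
  have hWL : W * Real.log p < (p : ℝ) * Real.exp (-x) * Real.log 2 * Real.log p :=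
    mul_lt_mul_of_pos_right hSt hLpos
  -- `p log p exp(-x) = (p-1) log p exp(-x) + log p exp(-x) ≤ ε e + ε e/(p-1) ≤ ε e + ε`
  have hsecond : Real.log p * Real.exp (-x) ≤ ε := by
    -- `log p exp(-x) ≤ ((p-1) log p exp(-x)) / (p-1) ≤ ε e/(p-1) ≤ ε`
    have h1 : Real.log p * Real.exp (-x) * ((p : ℝ) - 1) ≤ ε * (e : ℝ) := by
      calc Real.log p * Real.exp (-x) * ((p : ℝ) - 1)
          = ((p : ℝ) - 1) * Real.log p * Real.exp (-x) := by ring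
        _ ≤ ε * (e : ℝ) := hmain
    have h2 : ε * (e : ℝ) ≤ ε * ((p : ℝ) - 1) := mul_le_mul_of_nonneg_left heleR hε.le
    have h3 : Real.log p * Real.exp (-x) * ((p : ℝ) - 1) ≤ ε * ((p : ℝ) - 1) := le_trans h1 h2
    have h4 : 0 < (p : ℝ) - 1 := by linarith
    exact le_of_mul_le_mul_right h3 h4
  have htotal : (p : ℝ) * Real.exp (-x) * Real.log 2 * Real.log p ≤
      ε * (e : ℝ) * Real.log 2 + ε * Real.log 2 := by
    have : (p : ℝ) * Real.exp (-x) * Real.log 2 * Real.log p =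
        (((p : ℝ) - 1) * Real.log p * Real.exp (-x) + Real.log p * Real.exp (-x)) * Real.log 2 := by
      ring
    rw [this]
    have h5 : ((p : ℝ) - 1) * Real.log p * Real.exp (-x) + Real.log p * Real.exp (-x) ≤
        ε * (e : ℝ) + ε := add_le_add hmain hsecond
    calc (((p : ℝ) - 1) * Real.log p * Real.exp (-x) + Real.log p * Real.exp (-x)) * Real.log 2
        ≤ (ε * (e : ℝ) + ε) * Real.log 2 := mul_le_mul_of_nonneg_right h5 hlog2.le
      _ = ε * (e : ℝ) * Real.log 2 + ε * Real.log 2 := by ring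
  have hP0 : 0 ≤ P₀ * Real.log 2 := by positivity
  linarith

/-- Tangent-line inequality for `y ↦ y^4` at `y = ℓ`: `4 ℓ^3 y ≤ y^4 + 3 ℓ^4`. -/
theorem soloInformed_four_mul_cube_mul_le (y ℓ : ℝ) : 4 * ℓ ^ 3 * y ≤ y ^ 4 + 3 * ℓ ^ 4 := by
  have h : 0 ≤ (y - ℓ) ^ 2 * ((y + ℓ) ^ 2 + 2 * ℓ ^ 2) := by positivity
  have h' : (y - ℓ) ^ 2 * ((y + ℓ) ^ 2 + 2 * ℓ ^ 2) = y ^ 4 + 3 * ℓ ^ 4 - 4 * ℓ ^ 3 * y := by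
    ring
  linarith

/-- **"Corollary D" follows from Stewart's Theorem 2.** Under `stewart2013_thm2`: for every
`ε > 0` there are `δ > 0` and `K` with `W(p)·log p ≤ ε·e_p·log 2 + K` for every odd prime `p`
whose residual index satisfies `(log i_p)^4 ≤ δ·log p` — literally the statement of
`soloInformed_onePrime_growingIndex_of_subgroupTwoLogBound`, here obtained without any
two-logarithm or subgroup input (one may take `δ = 1`). -/
theorem soloInformed_corollaryD_of_stewartThm2 (hS : stewart2013_thm2) {ε : ℝ} (hε : 0 < ε) :
    ∃ δ : ℝ, 0 < δ ∧ ∃ K : ℝ, ∀ p : ℕ, p.Prime → p ≠ 2 →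
      Real.log (((p : ℝ) - 1) / (orderOf (2 : ZMod p) : ℝ)) ^ 4 ≤ δ * Real.log p →
      (padicValNat p (2 ^ (p - 1) - 1) : ℝ) * Real.log p
        ≤ ε * (orderOf (2 : ZMod p) : ℝ) * Real.log 2 + K := by
  obtain ⟨K₁, hK₁⟩ := soloInformed_onePrime_stewartRange_of_stewartThm2 hS hε
  have hlog2 : 0 < Real.log 2 := Real.log_pos one_lt_two
  -- threshold: `C (log L)^2 ≤ L` with `C = 104 (7/4 + |log ε|)`, and `log L ≥ 6`
  obtain ⟨L₀, hL₀⟩ := eventually_const_mul_log_sq_le (104 * (7 / 4 + |Real.log ε|))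
  set L₁ : ℝ := max L₀ (Real.exp 6) with hL₁
  have hL₁0 : 0 < L₁ := lt_of_lt_of_le (Real.exp_pos 6) (le_max_right _ _)
  set P : ℝ := Real.exp L₁ with hP
  have hP0 : 0 < P := Real.exp_pos _
  refine ⟨1, one_pos, max K₁ 0 + P * Real.log 2, fun p hp hp2 hreg => ?_⟩
  haveI : Fact p.Prime := ⟨hp⟩
  have h2ne0 : (2 : ZMod p) ≠ 0 := by
    intro h
    have : p ∣ 2 := (ZMod.natCast_eq_zero_iff 2 p).mp (by exact_mod_cast h)
    exact hp2 ((Nat.prime_dvd_prime_iff_eq hp Nat.prime_two).mp this)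
  have htriv := soloInformed_wieferichExp_mul_log_lt hp hp2
  have hK₁p := hK₁ p hp hp2
  set e : ℕ := orderOf (2 : ZMod p) with he
  have hediv : e ∣ p - 1 := ZMod.orderOf_dvd_card_sub_one h2ne0
  clear_value e
  have hp3 : 3 ≤ p := by have := hp.two_le; omega
  have hp1pos : 0 < p - 1 := by omega
  have hepos : 0 < e := Nat.pos_of_dvd_of_pos hediv hp1pos
  have hele : e ≤ p - 1 := Nat.le_of_dvd hp1pos hediv
  have hpR : (3 : ℝ) ≤ (p : ℝ) := by exact_mod_cast hp3
  have heR : (0 : ℝ) < (e : ℝ) := by exact_mod_cast hepos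
  have heleR : (e : ℝ) ≤ (p : ℝ) - 1 := by
    have : ((e : ℕ) : ℝ) ≤ ((p - 1 : ℕ) : ℝ) := by exact_mod_cast hele
    rw [Nat.cast_sub hp.one_le] at this
    simpa using this
  have hp0 : (0 : ℝ) < (p : ℝ) := by linarith
  have hLpos : 0 < Real.log p := Real.log_pos (by linarith)
  have hεe : 0 ≤ ε * (e : ℝ) * Real.log 2 := by positivity
  have hK0 : K₁ ≤ max K₁ 0 := le_max_left _ _
  have hK0' : 0 ≤ max K₁ 0 := le_max_right _ _
  by_cases hsmall : (p : ℝ) < P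
  · -- small primes: Liouville
    have h1 : (e : ℝ) * Real.log 2 ≤ P * Real.log 2 :=
      mul_le_mul_of_nonneg_right (by linarith) hlog2.le
    linarith
  push Not at hsmall
  -- `L = log p ≥ L₁`, `ℓ = log L ≥ 6`
  set L : ℝ := Real.log p with hL
  have hLL₁ : L₁ ≤ L := by
    rw [hL, ← Real.log_exp L₁]
    exact Real.log_le_log hP0 hsmall
  have hLL₀ : L₀ ≤ L := le_trans (le_max_left _ _) hLL₁
  have hL6 : Real.exp 6 ≤ L := le_trans (le_max_right _ _) hLL₁
  have hL0 : 0 < L := hLpos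
  set ℓ : ℝ := Real.log L with hℓ
  have hℓ6 : 6 ≤ ℓ := by
    rw [hℓ, ← Real.log_exp 6]; exact Real.log_le_log (Real.exp_pos 6) hL6
  have hℓ0 : 0 < ℓ := by linarith
  have hCL : 104 * (7 / 4 + |Real.log ε|) * ℓ ^ 2 ≤ L := hL₀ L hLL₀
  -- the index `i = (p-1)/e ≥ 1` and `y = log i ≥ 0`
  set i : ℝ := ((p : ℝ) - 1) / (e : ℝ) with hi
  have hi1 : 1 ≤ i := by rw [hi, le_div_iff₀ heR]; linarith
  have hi0 : 0 < i := by linarith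
  set y : ℝ := Real.log i with hy
  have hy0 : 0 ≤ y := Real.log_nonneg hi1
  have hy4 : y ^ 4 ≤ L := by simpa using hreg
  -- tangent line: `y ≤ L/(4 ℓ^3) + (3/4) ℓ`
  have htan := soloInformed_four_mul_cube_mul_le y ℓ
  have hℓ3 : 0 < ℓ ^ 3 := by positivity
  have hyb : 4 * ℓ ^ 3 * y ≤ L + 3 * ℓ ^ 4 := by linarith
  -- (a) `L/(4 ℓ^3) ≤ L/(104 ℓ)` since `ℓ^2 ≥ 26`; (b) `(7/4) ℓ + |log ε| ≤ L/(104 ℓ)`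
  have hℓ2 : 26 ≤ ℓ ^ 2 := by
    have : (6 : ℝ) ^ 2 ≤ ℓ ^ 2 := pow_le_pow_left₀ (by norm_num) hℓ6 2
    linarith [show ((6 : ℝ)) ^ 2 = 36 by norm_num]
  have hℓ1 : 1 ≤ ℓ := by linarith
  -- Goal: `y + ℓ ≤ log ε + L/(52 ℓ)`; everything multiplied by `104 ℓ^3 > 0`
  have hkey : y + ℓ ≤ Real.log ε + L / (52 * ℓ) := by
    have hlogε : -|Real.log ε| ≤ Real.log ε := neg_abs_le _
    set A : ℝ := |Real.log ε| with hA
    have habs : 0 ≤ A := abs_nonneg _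
    -- (a) `104 ℓ^3 y ≤ 26 L + 78 ℓ^4 ≤ L ℓ^2 + 78 ℓ^4`
    have h1a : 104 * ℓ ^ 3 * y ≤ 26 * L + 78 * ℓ ^ 4 := by linarith
    have h1b : 26 * L ≤ L * ℓ ^ 2 := by nlinarith
    have h1 : 104 * ℓ ^ 3 * y ≤ L * ℓ ^ 2 + 78 * ℓ ^ 4 := by linarith
    -- (b) from `hCL`: `182 ℓ^2 + 104 A ℓ^2 ≤ L`, times `ℓ^2`: `182 ℓ^4 + 104 A ℓ^4 ≤ L ℓ^2`
    have hCL' : 182 * ℓ ^ 2 + 104 * A * ℓ ^ 2 ≤ L := by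
      have : 104 * (7 / 4 + A) * ℓ ^ 2 = 182 * ℓ ^ 2 + 104 * A * ℓ ^ 2 := by ring
      linarith
    have hℓ20 : 0 ≤ ℓ ^ 2 := sq_nonneg _
    have h2 : 182 * ℓ ^ 4 + 104 * A * ℓ ^ 4 ≤ L * ℓ ^ 2 := by
      have := mul_le_mul_of_nonneg_right hCL' hℓ20
      have e1 : (182 * ℓ ^ 2 + 104 * A * ℓ ^ 2) * ℓ ^ 2 = 182 * ℓ ^ 4 + 104 * A * ℓ ^ 4 := by
        ring
      linarith
    -- (c) `A ℓ^3 ≤ A ℓ^4` (`ℓ ≥ 1`)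
    have h34 : A * ℓ ^ 3 ≤ A * ℓ ^ 4 := by
      have : ℓ ^ 3 ≤ ℓ ^ 4 := by
        calc ℓ ^ 3 = ℓ ^ 3 * 1 := by ring
          _ ≤ ℓ ^ 3 * ℓ := mul_le_mul_of_nonneg_left hℓ1 hℓ3.le
          _ = ℓ ^ 4 := by ring
      exact mul_le_mul_of_nonneg_left this habs
    -- sum: `104 ℓ^3 (y + ℓ + A) ≤ 2 L ℓ^2`
    have h3 : 104 * ℓ ^ 3 * (y + ℓ + A) ≤ 2 * L * ℓ ^ 2 := by
      have e1 : 104 * ℓ ^ 3 * (y + ℓ + A) = 104 * ℓ ^ 3 * y + 104 * ℓ ^ 4 + 104 * (A * ℓ ^ 3) := by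
        ring
      rw [e1]
      nlinarith
    have h4 : y + ℓ + A ≤ L / (52 * ℓ) := by
      rw [le_div_iff₀ (by positivity)]
      have e1 : (y + ℓ + A) * (52 * ℓ) * (2 * ℓ ^ 2) ≤ L * (2 * ℓ ^ 2) := by
        calc (y + ℓ + A) * (52 * ℓ) * (2 * ℓ ^ 2) = 104 * ℓ ^ 3 * (y + ℓ + A) := by ring
          _ ≤ 2 * L * ℓ ^ 2 := h3
          _ = L * (2 * ℓ ^ 2) := by ring
      exact le_of_mul_le_mul_right e1 (by positivity)
    linarith
  -- exponentiate: `i L = exp(y + ℓ) ≤ ε exp(L/(52 ℓ))`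
  have hiL : i * L ≤ ε * Real.exp (L / (52 * ℓ)) := by
    have h1 : Real.exp (y + ℓ) ≤ Real.exp (Real.log ε + L / (52 * ℓ)) := Real.exp_le_exp.mpr hkey
    rw [Real.exp_add, Real.exp_add, hy, hℓ, Real.exp_log hi0, Real.exp_log hL0,
      Real.exp_log hε] at h1
    exact h1
  have := hK₁p (by simpa [hi, hL, hℓ] using hiL)
  have hPl : 0 ≤ P * Real.log 2 := by positivity
  linarith

/-- **"Corollary D" from Yu's theorem.** The same statement from the named fact
`Stewart2013_lemma5_rat` (Yu 2013 over `ℚ` in Stewart's form), through the tree's reduction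
`stewart2013_thm2_of_Stewart2013_lemma5_rat` (Lemma 5 ⇒ Lemma 8 ⇒ Theorem 2, all proved). -/
theorem soloInformed_corollaryD_of_lemma5Rat (hY : Stewart2013_lemma5_rat) {ε : ℝ} (hε : 0 < ε) :
    ∃ δ : ℝ, 0 < δ ∧ ∃ K : ℝ, ∀ p : ℕ, p.Prime → p ≠ 2 →
      Real.log (((p : ℝ) - 1) / (orderOf (2 : ZMod p) : ℝ)) ^ 4 ≤ δ * Real.log p →
      (padicValNat p (2 ^ (p - 1) - 1) : ℝ) * Real.log p
        ≤ ε * (orderOf (2 : ZMod p) : ℝ) * Real.log 2 + K :=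
  soloInformed_corollaryD_of_stewartThm2 (stewart2013_thm2_of_Stewart2013_lemma5_rat hY) hε

/-- **(F5) on Stewart's range from Yu's theorem.** -/
theorem soloInformed_onePrime_stewartRange_of_lemma5Rat (hY : Stewart2013_lemma5_rat) {ε : ℝ}
    (hε : 0 < ε) :
    ∃ K : ℝ, ∀ p : ℕ, p.Prime → p ≠ 2 →
      ((p : ℝ) - 1) / (orderOf (2 : ZMod p) : ℝ) * Real.log p ≤
          ε * Real.exp (Real.log p / (52 * Real.log (Real.log p))) →
      (padicValNat p (2 ^ (p - 1) - 1) : ℝ) * Real.log p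
        ≤ ε * (orderOf (2 : ZMod p) : ℝ) * Real.log 2 + K :=
  soloInformed_onePrime_stewartRange_of_stewartThm2 (stewart2013_thm2_of_Stewart2013_lemma5_rat hY) hε

end Summit.ABC.ABC.Theorems
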